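import Mathlib
import Literature.MathematicalPhysics.QuantumFieldTheory.Luscher2010.TrivializingMaps
import Literature.MathematicalPhysics.QuantumFieldTheory.Luscher2010.EulerStepProofs
import Summits.Ventures.LatticeQCDFlow.TrivializingMaps.Truncation
import Summits.Ventures.LatticeQCDFlow.TrivializingMaps.TruncationDefect
import Summits.Ventures.LatticeQCDFlow.Exactness.GaugeEquivariance
import HarnessLib

/-!
# Gauge covariance of gradient flows: `Φ_t(V^g) = Φ_t(V)^g` for gauge-invariant flow actions

HONEST FRAMING: exact (Metropolis-corrected) sampling algorithms for lattice gauge theory; figures of merit are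
autocorrelation/cost numbers at stated couplings and volumes; no continuum-physics claim.

Lüscher §3.1/§4.2/§6: the trivializing flow is generated by `Z_t = -∂S̃_t` with `S̃_t` a sum of Wilson loops,
hence gauge invariant; "the map preserves the gauge symmetry". This file proves, on the finite field manifold
`SU(n)^E` and for ANY family of flow actions `S̃_t` that are gauge invariant on `SU(n)^E` and differentiable:
* `linkDeriv_gaugeTransform`: `∂_{e,Y} f(U^g) = ∂_{e, g(x)ᴴ Y g(x)} f(U)` (`x` = source of `e`; no
  differentiability needed — the two link curves are gauge transforms of each other);
* `linkGrad_gaugeTransform`: `∂f(U^g)(e) = g(x) ∂f(U)(e) g(x)ᴴ` (the gradient transforms in the adjoint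
  representation; uses `ℝ`-linearity of `Y ↦ ∂_{e,Y} f` for differentiable `f` and `Ad`-orthogonality of the
  trace form (A.2));
* `isFlowLine_gaugeTransform`: gauge transforms of flow lines of `-∂S̃_t` are flow lines;
* `isGaugeEquivariant_flowMap`: with unique flow lines (e.g. under `FlowGlobalExistence`), every time-`t` map
  of the flow is `IsGaugeEquivariant` (venture `Exactness/GaugeEquivariance.lean`), in particular the
  trivializing map `Φ_1` and every truncated Lüscher map (`isGaugeEquivariant_truncFlow`).
(The Wilson-flow case is the tree's `wilsonFlow_gaugeTransform`; here the generator is a general gradient.)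

References: M. Lüscher, Trivializing maps, the Wilson flow and the HMC algorithm, CMP 293 (2010) 899
[Luscher2010Trivializing, arXiv:0907.5491], §3.1 eqs. (3.1)–(3.3), §4.2 eq. (4.4), §4.3, App. A eqs.
(A.1)–(A.5), (A.10).
-/

namespace Summit.Ventures.LatticeQCDFlow.TrivializingMaps

open Literature.MathematicalPhysics.QuantumFieldTheory
open Literature.MathematicalPhysics.QuantumFieldTheory.Luscher2010
open Summit.Ventures.LatticeQCDFlow.Exactness (IsGaugeEquivariant)
open scoped Matrix Matrix.Norms.Frobenius ContDiff

variable {d L n : ℕ}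

/-! ## §1. Algebra: `Ad`-invariance of `𝔰𝔲(n)`, of the trace form, and of one-parameter subgroups -/

section Algebra

/-- `𝔰𝔲(n)` is stable under `X ↦ gᴴ X g`, `g ∈ SU(n)` (adjoint action of `g⁻¹`). [folklore] -/
theorem conjTranspose_mul_mul_mem_suAlgebra (g : Matrix.specialUnitaryGroup (Fin n) ℂ)
    {X : Matrix (Fin n) (Fin n) ℂ} (hX : X ∈ suAlgebra n) :
    (g : Matrix (Fin n) (Fin n) ℂ)ᴴ * X * (g : Matrix (Fin n) (Fin n) ℂ) ∈ suAlgebra n := by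
  rw [mem_suAlgebra_iff] at hX ⊢
  refine ⟨?_, ?_⟩
  · simp only [Matrix.conjTranspose_mul, Matrix.conjTranspose_conjTranspose, hX.1, Matrix.mul_neg,
      Matrix.neg_mul, Matrix.mul_assoc]
  · rw [Matrix.mul_assoc, Matrix.trace_mul_comm, Matrix.mul_assoc,
      WilsonFlow.mul_conjTranspose_self_SU, Matrix.mul_one, hX.2]

/-- `𝔰𝔲(n)` is stable under `X ↦ g X gᴴ`, `g ∈ SU(n)` (adjoint action). [folklore] -/
theorem mul_mul_conjTranspose_mem_suAlgebra (g : Matrix.specialUnitaryGroup (Fin n) ℂ)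
    {X : Matrix (Fin n) (Fin n) ℂ} (hX : X ∈ suAlgebra n) :
    (g : Matrix (Fin n) (Fin n) ℂ) * X * (g : Matrix (Fin n) (Fin n) ℂ)ᴴ ∈ suAlgebra n := by
  have h := conjTranspose_mul_mul_mem_suAlgebra g⁻¹ hX
  rwa [WilsonFlow.coe_inv_SU, Matrix.conjTranspose_conjTranspose] at h

/-- One-parameter subgroups of `𝔰𝔲(n)` elements lie in `SU(n)`: `e^{sY} ∈ SU(n)`.
[cite: Luscher2010Trivializing, App. A.1] -/
theorem exp_smul_mem_specialUnitaryGroup {Y : Matrix (Fin n) (Fin n) ℂ} (hY : Y ∈ suAlgebra n) (s : ℝ) :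
    NormedSpace.exp ((s : ℂ) • Y) ∈ Matrix.specialUnitaryGroup (Fin n) ℂ := by
  rw [mem_suAlgebra_iff] at hY
  refine exp_mem_specialUnitaryGroup ?_ ?_
  · rw [Matrix.conjTranspose_smul, hY.1, smul_neg, Complex.star_def, Complex.conj_ofReal]
  · rw [Matrix.trace_smul, hY.2, smul_zero]

/-- Conjugation passes through the exponential: `e^{s gᴴ Y g} = gᴴ e^{sY} g` for `g ∈ SU(n)`.
[folklore] -/
theorem exp_smul_conjTranspose_mul_mul (g : Matrix.specialUnitaryGroup (Fin n) ℂ)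
    (Y : Matrix (Fin n) (Fin n) ℂ) (s : ℝ) :
    NormedSpace.exp ((s : ℂ) • ((g : Matrix (Fin n) (Fin n) ℂ)ᴴ * Y * (g : Matrix (Fin n) (Fin n) ℂ))) =
      (g : Matrix (Fin n) (Fin n) ℂ)ᴴ * NormedSpace.exp ((s : ℂ) • Y) * (g : Matrix (Fin n) (Fin n) ℂ) := by
  let u : (Matrix (Fin n) (Fin n) ℂ)ˣ :=
    ⟨(g : Matrix (Fin n) (Fin n) ℂ), (g : Matrix (Fin n) (Fin n) ℂ)ᴴ,
      WilsonFlow.mul_conjTranspose_self_SU g, WilsonFlow.conjTranspose_mul_self_SU g⟩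
  have h := NormedSpace.exp_units_conj' u ((s : ℂ) • Y)
  have e1 : (s : ℂ) • ((g : Matrix (Fin n) (Fin n) ℂ)ᴴ * Y * (g : Matrix (Fin n) (Fin n) ℂ)) =
      (u⁻¹ : (Matrix (Fin n) (Fin n) ℂ)ˣ) * ((s : ℂ) • Y) * (u : Matrix (Fin n) (Fin n) ℂ) := by
    rw [Matrix.mul_smul, Matrix.smul_mul]; rfl
  rw [e1]; exact h

/-- `Ad`-ORTHOGONALITY of the trace form: the matrix of `Ad_g` in an orthonormal basis is the transpose of
that of `Ad_{g⁻¹}`: `(g T^b gᴴ)^a = (gᴴ T^a g)^b` (coordinates (A.10)). [cite: Luscher2010Trivializing, App. A eqs. (A.2), (A.10)] -/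
theorem coord_conj_eq_coord_conj_symm (B : SuBasis n) (g : Matrix.specialUnitaryGroup (Fin n) ℂ)
    (a b : B.ι) :
    B.coord a ((g : Matrix (Fin n) (Fin n) ℂ) * B.T b * (g : Matrix (Fin n) (Fin n) ℂ)ᴴ) =
      B.coord b ((g : Matrix (Fin n) (Fin n) ℂ)ᴴ * B.T a * (g : Matrix (Fin n) (Fin n) ℂ)) := by
  have h : (B.T a * ((g : Matrix (Fin n) (Fin n) ℂ) * B.T b * (g : Matrix (Fin n) (Fin n) ℂ)ᴴ)).trace =
      (B.T b * ((g : Matrix (Fin n) (Fin n) ℂ)ᴴ * B.T a * (g : Matrix (Fin n) (Fin n) ℂ))).trace :=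
    calc (B.T a * ((g : Matrix (Fin n) (Fin n) ℂ) * B.T b * (g : Matrix (Fin n) (Fin n) ℂ)ᴴ)).trace
        = (((g : Matrix (Fin n) (Fin n) ℂ) * B.T b * (g : Matrix (Fin n) (Fin n) ℂ)ᴴ) * B.T a).trace :=
          Matrix.trace_mul_comm _ _
      _ = ((g : Matrix (Fin n) (Fin n) ℂ) * (B.T b * (g : Matrix (Fin n) (Fin n) ℂ)ᴴ * B.T a)).trace := by
          simp only [Matrix.mul_assoc]
      _ = ((B.T b * (g : Matrix (Fin n) (Fin n) ℂ)ᴴ * B.T a) * (g : Matrix (Fin n) (Fin n) ℂ)).trace :=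
          Matrix.trace_mul_comm _ _
      _ = (B.T b * ((g : Matrix (Fin n) (Fin n) ℂ)ᴴ * B.T a * (g : Matrix (Fin n) (Fin n) ℂ))).trace := by
          simp only [Matrix.mul_assoc]
  show -2 * (B.T a * ((g : Matrix (Fin n) (Fin n) ℂ) * B.T b * (g : Matrix (Fin n) (Fin n) ℂ)ᴴ)).trace.re =
    -2 * (B.T b * ((g : Matrix (Fin n) (Fin n) ℂ)ᴴ * B.T a * (g : Matrix (Fin n) (Fin n) ℂ))).trace.re
  rw [h]

/-- Coordinates of a basis expansion: `(∑_b c_b T^b)^a = c_a` (orthonormality (A.2) with (A.10)).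
[cite: Luscher2010Trivializing, App. A eqs. (A.2), (A.10)] -/
private theorem coord_sum_smul (B : SuBasis n) (c : B.ι → ℝ) (a : B.ι) :
    B.coord a (∑ b, ((c b : ℝ) : ℂ) • B.T b) = c a := by
  have h : (B.T a * ∑ b, ((c b : ℝ) : ℂ) • B.T b).trace = ((c a : ℝ) : ℂ) * (-(1 / 2 : ℂ)) := by
    rw [Finset.mul_sum, Matrix.trace_sum]
    simp_rw [Matrix.mul_smul, Matrix.trace_smul, B.orth, smul_eq_mul, mul_ite, mul_zero]
    rw [Finset.sum_ite_eq]
    simp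
  unfold SuBasis.coord
  rw [h, show ((c a : ℝ) : ℂ) * (-(1 / 2 : ℂ)) = ((c a * (-(1 / 2)) : ℝ) : ℂ) by push_cast; ring,
    Complex.ofReal_re]
  ring

/-- Completeness (A.5) in coordinates: `X = ∑_a X^a T^a` for `X ∈ 𝔰𝔲(n)`.
[cite: Luscher2010Trivializing, App. A eqs. (A.5), (A.10)] -/
theorem sum_coord_smul_eq (B : SuBasis n) {X : Matrix (Fin n) (Fin n) ℂ} (hX : X ∈ suAlgebra n) :
    ∑ a, ((B.coord a X : ℝ) : ℂ) • B.T a = X := by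
  obtain ⟨c, rfl⟩ := B.span X hX
  exact Finset.sum_congr rfl fun a _ => by rw [coord_sum_smul]

/-- The adjoint action in the basis: `∑_a (gᴴ T^a g)^b T^a = g T^b gᴴ` (`Ad`-orthogonality + completeness).
[cite: Luscher2010Trivializing, App. A eqs. (A.2), (A.5), (A.10)] -/
theorem sum_coord_conj_smul (B : SuBasis n) (g : Matrix.specialUnitaryGroup (Fin n) ℂ) (b : B.ι) :
    ∑ a, ((B.coord b ((g : Matrix (Fin n) (Fin n) ℂ)ᴴ * B.T a * (g : Matrix (Fin n) (Fin n) ℂ)) : ℝ) : ℂ) •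
        B.T a =
      (g : Matrix (Fin n) (Fin n) ℂ) * B.T b * (g : Matrix (Fin n) (Fin n) ℂ)ᴴ := by
  simp_rw [← coord_conj_eq_coord_conj_symm B g _ b]
  exact sum_coord_smul_eq B (mul_mul_conjTranspose_mem_suAlgebra g (B.mem b))

end Algebra

/-! ## §2. Configurations: gauge transforms of link updates -/

section Configs

/-- `coe` of a one-link update is the one-link update of `coe`. [folklore] -/
theorem coeConfig_update (U : GaugeConfig d L (Matrix.specialUnitaryGroup (Fin n) ℂ)) (e : Edge d L)
    (u : Matrix.specialUnitaryGroup (Fin n) ℂ) :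
    WilsonFlow.coeConfig (Function.update U e u) =
      Function.update (WilsonFlow.coeConfig U) e (u : Matrix (Fin n) (Fin n) ℂ) := by
  funext e'
  by_cases h : e' = e
  · subst h; simp [WilsonFlow.coeConfig_apply]
  · simp [WilsonFlow.coeConfig_apply, Function.update_of_ne h]

/-- Gauge transform of a one-link update. [folklore] -/
theorem gaugeTransform_update (g : Site d L → Matrix.specialUnitaryGroup (Fin n) ℂ)
    (U : GaugeConfig d L (Matrix.specialUnitaryGroup (Fin n) ℂ)) (e : Edge d L)
    (u : Matrix.specialUnitaryGroup (Fin n) ℂ) :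
    gaugeTransform g (Function.update U e u) =
      Function.update (gaugeTransform g U) e (g e.1 * u * (g (e.1.shift e.2))⁻¹) := by
  funext e'
  by_cases h : e' = e
  · subst h; simp [gaugeTransform]
  · simp [gaugeTransform, Function.update_of_ne h]

/-- `U^g(e) = g(x) U(e) g(x+μ̂)ᴴ` as matrices. [folklore] -/
theorem coeConfig_gaugeTransform_apply (g : Site d L → Matrix.specialUnitaryGroup (Fin n) ℂ)
    (U : GaugeConfig d L (Matrix.specialUnitaryGroup (Fin n) ℂ)) (e : Edge d L) :
    WilsonFlow.coeConfig (gaugeTransform g U) e =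
      (g e.1 : Matrix (Fin n) (Fin n) ℂ) * WilsonFlow.coeConfig U e *
        ((g (e.1.shift e.2) : Matrix.specialUnitaryGroup (Fin n) ℂ) : Matrix (Fin n) (Fin n) ℂ)ᴴ := by
  simp [gaugeTransform, WilsonFlow.coeConfig_apply]

end Configs

/-! ## §3. Covariance of link derivatives and of the gradient -/

section Covariance

/-- **Link derivatives of a gauge-invariant function are `Ad`-covariant**:
`∂_{e,Y} f(U^g) = ∂_{e, g(x)ᴴ Y g(x)} f(U)` for `Y ∈ 𝔰𝔲(n)` — the link curve `s ↦ (e^{sY} U^g(e), …)` is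
the gauge transform of the link curve `s ↦ (e^{s g(x)ᴴYg(x)} U(e), …)`, so the two real functions of `s`
being differentiated COINCIDE (no differentiability of `f` needed). [cite: Luscher2010Trivializing, §2.2 eq. (2.2), §3.1] -/
theorem linkDeriv_gaugeTransform {f : AmbConfig d L n → ℝ}
    (hf : IsGaugeInvariant fun U : GaugeConfig d L (Matrix.specialUnitaryGroup (Fin n) ℂ) =>
      f (WilsonFlow.coeConfig U))
    (g : Site d L → Matrix.specialUnitaryGroup (Fin n) ℂ)
    (U : GaugeConfig d L (Matrix.specialUnitaryGroup (Fin n) ℂ)) (e : Edge d L)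
    {Y : Matrix (Fin n) (Fin n) ℂ} (hY : Y ∈ suAlgebra n) :
    linkDeriv e Y f (WilsonFlow.coeConfig (gaugeTransform g U)) =
      linkDeriv e ((g e.1 : Matrix (Fin n) (Fin n) ℂ)ᴴ * Y * (g e.1 : Matrix (Fin n) (Fin n) ℂ)) f
        (WilsonFlow.coeConfig U) := by
  unfold linkDeriv
  congr 1
  funext s
  have hmem : NormedSpace.exp ((s : ℂ) • ((g e.1 : Matrix (Fin n) (Fin n) ℂ)ᴴ * Y *
      (g e.1 : Matrix (Fin n) (Fin n) ℂ))) * (U e : Matrix (Fin n) (Fin n) ℂ) ∈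
        Matrix.specialUnitaryGroup (Fin n) ℂ :=
    mul_mem (exp_smul_mem_specialUnitaryGroup (conjTranspose_mul_mul_mem_suAlgebra (g e.1) hY) s) (U e).2
  have h1 : Function.update (WilsonFlow.coeConfig U) e
      (NormedSpace.exp ((s : ℂ) • ((g e.1 : Matrix (Fin n) (Fin n) ℂ)ᴴ * Y *
        (g e.1 : Matrix (Fin n) (Fin n) ℂ))) * WilsonFlow.coeConfig U e) =
      WilsonFlow.coeConfig (Function.update U e ⟨_, hmem⟩) := by
    rw [coeConfig_update]; rfl
  have h2 : Function.update (WilsonFlow.coeConfig (gaugeTransform g U)) e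
      (NormedSpace.exp ((s : ℂ) • Y) * WilsonFlow.coeConfig (gaugeTransform g U) e) =
      WilsonFlow.coeConfig (gaugeTransform g (Function.update U e ⟨_, hmem⟩)) := by
    rw [gaugeTransform_update, coeConfig_update, coeConfig_gaugeTransform_apply]
    congr 1
    rw [WilsonFlow.coe_mul_SU, WilsonFlow.coe_mul_SU, WilsonFlow.coe_inv_SU]
    show NormedSpace.exp ((s : ℂ) • Y) * ((g e.1 : Matrix (Fin n) (Fin n) ℂ) * WilsonFlow.coeConfig U e *
        ((g (e.1.shift e.2) : Matrix.specialUnitaryGroup (Fin n) ℂ) : Matrix (Fin n) (Fin n) ℂ)ᴴ) =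
      (g e.1 : Matrix (Fin n) (Fin n) ℂ) * (NormedSpace.exp ((s : ℂ) •
        ((g e.1 : Matrix (Fin n) (Fin n) ℂ)ᴴ * Y * (g e.1 : Matrix (Fin n) (Fin n) ℂ))) *
          (U e : Matrix (Fin n) (Fin n) ℂ)) *
        ((g (e.1.shift e.2) : Matrix.specialUnitaryGroup (Fin n) ℂ) : Matrix (Fin n) (Fin n) ℂ)ᴴ
    rw [exp_smul_conjTranspose_mul_mul]
    simp only [← Matrix.mul_assoc, WilsonFlow.mul_conjTranspose_self_SU, Matrix.one_mul,
      WilsonFlow.coeConfig_apply]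
  rw [h1, h2]
  exact hf g _

/-- `δ_e`-embedding of a finite sum. [folklore] -/
private theorem pi_single_sum (e : Edge d L) {ι : Type} [Fintype ι]
    (v : ι → Matrix (Fin n) (Fin n) ℂ) :
    (Pi.single e (∑ a, v a) : AmbConfig d L n) = ∑ a, (Pi.single e (v a) : AmbConfig d L n) := by
  funext e'
  simp only [Finset.sum_apply, Pi.single_apply]
  split_ifs <;> simp

/-- `δ_e`-embedding of a real multiple. [folklore] -/
private theorem pi_single_real_smul (e : Edge d L) (c : ℝ) (M : Matrix (Fin n) (Fin n) ℂ) :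
    (Pi.single e (c • M) : AmbConfig d L n) = c • (Pi.single e M : AmbConfig d L n) := by
  funext e'
  simp only [Pi.smul_apply, Pi.single_apply]
  split_ifs <;> simp

variable [NeZero L]

/-- **`ℝ`-linearity of `Y ↦ ∂_{e,Y} f`** at a point of differentiability:
`∂_{e, ∑ c_a T^a} f = ∑ c_a ∂_{e,T^a} f` (the link derivative is `Df(W)[δ_e · Y W(e)]`).
[cite: Luscher2010Trivializing, App. A eq. (A.3)] -/
theorem linkDeriv_sum_smul {f : AmbConfig d L n → ℝ} {W : AmbConfig d L n} (hf : DifferentiableAt ℝ f W)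
    (e : Edge d L) {ι : Type} [Fintype ι] (c : ι → ℝ) (T : ι → Matrix (Fin n) (Fin n) ℂ) :
    linkDeriv e (∑ a, ((c a : ℝ) : ℂ) • T a) f W = ∑ a, c a * linkDeriv e (T a) f W := by
  simp_rw [linkDeriv_eq_fderiv hf]
  rw [Finset.sum_mul, pi_single_sum, map_sum]
  refine Finset.sum_congr rfl fun a _ => ?_
  rw [Complex.coe_smul, Matrix.smul_mul, pi_single_real_smul, ContinuousLinearMap.map_smul, smul_eq_mul]

/-- **The gradient transforms in the adjoint representation**: `∂f(U^g)(e) = g(x) ∂f(U)(e) g(x)ᴴ` for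
`f` gauge invariant on `SU(n)^E` and differentiable — hence the generator `Z_t = -∂S̃_t` (4.4) of a
gauge-invariant flow action satisfies `Z_t(U^g) = g Z_t(U) g⁻¹`, as the Wilson generator does (§3.1).
[cite: Luscher2010Trivializing, §3.1, §4.2 eq. (4.4), App. A] -/
theorem linkGrad_gaugeTransform (B : SuBasis n) {f : AmbConfig d L n → ℝ}
    (hf : IsGaugeInvariant fun U : GaugeConfig d L (Matrix.specialUnitaryGroup (Fin n) ℂ) =>
      f (WilsonFlow.coeConfig U))
    (hfd : Differentiable ℝ f) (g : Site d L → Matrix.specialUnitaryGroup (Fin n) ℂ)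
    (U : GaugeConfig d L (Matrix.specialUnitaryGroup (Fin n) ℂ)) (e : Edge d L) :
    linkGrad B f (WilsonFlow.coeConfig (gaugeTransform g U)) e =
      (g e.1 : Matrix (Fin n) (Fin n) ℂ) * linkGrad B f (WilsonFlow.coeConfig U) e *
        (g e.1 : Matrix (Fin n) (Fin n) ℂ)ᴴ := by
  show (∑ a, ((linkDeriv e (B.T a) f (WilsonFlow.coeConfig (gaugeTransform g U)) : ℝ) : ℂ) • B.T a) =
    (g e.1 : Matrix (Fin n) (Fin n) ℂ) * (∑ b, ((linkDeriv e (B.T b) f (WilsonFlow.coeConfig U) : ℝ) : ℂ) •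
      B.T b) * (g e.1 : Matrix (Fin n) (Fin n) ℂ)ᴴ
  -- step 1: covariance of each link derivative, expand `gᴴ T^a g` in the basis, linearity
  have step : ∀ a, linkDeriv e (B.T a) f (WilsonFlow.coeConfig (gaugeTransform g U)) =
      ∑ b, B.coord b ((g e.1 : Matrix (Fin n) (Fin n) ℂ)ᴴ * B.T a * (g e.1 : Matrix (Fin n) (Fin n) ℂ)) *
        linkDeriv e (B.T b) f (WilsonFlow.coeConfig U) := by
    intro a
    rw [linkDeriv_gaugeTransform hf g U e (B.mem a),
      ← sum_coord_smul_eq B (conjTranspose_mul_mul_mem_suAlgebra (g e.1) (B.mem a)),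
      linkDeriv_sum_smul (hfd _) e]
    simp_rw [sum_coord_smul_eq B (conjTranspose_mul_mul_mem_suAlgebra (g e.1) (B.mem a))]
  simp_rw [step]
  -- step 2: swap the sums and use `Ad`-orthogonality
  rw [Finset.mul_sum, Finset.sum_mul]
  simp_rw [Matrix.mul_smul, Matrix.smul_mul, ← sum_coord_conj_smul B (g e.1), Finset.smul_sum,
    Complex.ofReal_sum, Finset.sum_smul, Complex.ofReal_mul]
  rw [Finset.sum_comm]
  refine Finset.sum_congr rfl fun b _ => Finset.sum_congr rfl fun a _ => ?_
  rw [mul_comm, mul_smul]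

end Covariance

/-! ## §4. Covariance of flow lines and equivariance of the flow maps -/

section Flow

variable [NeZero L]

/-- **Gauge transforms of gradient-flow lines are flow lines**: if `t ↦ Φ_t V` integrates
`Z_t = -∂S̃_t` (`S̃_t` gauge invariant, differentiable) then so does `t ↦ (Φ_t V)^g`, from `V^g`
(`d/dt (g U g'ᴴ) = g Z U g'ᴴ = (g Z gᴴ)(g U g'ᴴ)`). [cite: Luscher2010Trivializing, §3.1 eqs. (3.1)–(3.2)] -/
theorem isFlowLine_gaugeTransform (B : SuBasis n) {F : ℝ → AmbConfig d L n → ℝ}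
    (hFi : ∀ t, IsGaugeInvariant fun U : GaugeConfig d L (Matrix.specialUnitaryGroup (Fin n) ℂ) =>
      F t (WilsonFlow.coeConfig U))
    (hFd : ∀ t, Differentiable ℝ (F t)) (g : Site d L → Matrix.specialUnitaryGroup (Fin n) ℂ)
    {Φ : ℝ → GaugeConfig d L (Matrix.specialUnitaryGroup (Fin n) ℂ) →
      GaugeConfig d L (Matrix.specialUnitaryGroup (Fin n) ℂ)}
    (hΦ : IsFlowMap (fun t W => -linkGrad B (F t) W) Φ)
    (V : GaugeConfig d L (Matrix.specialUnitaryGroup (Fin n) ℂ)) :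
    IsFlowLine (fun t W => -linkGrad B (F t) W)
      fun s => WilsonFlow.coeConfig (gaugeTransform g (Φ s V)) := by
  intro t e i j
  have hU : HasDerivAt (fun s => WilsonFlow.coeConfig (Φ s V) e)
      (-linkGrad B (F t) (WilsonFlow.coeConfig (Φ t V)) e * WilsonFlow.coeConfig (Φ t V) e) t :=
    WilsonFlow.hasDerivAt_of_entries fun i j => hΦ.2 V t e i j
  have h2 := (hU.const_mul (g e.1 : Matrix (Fin n) (Fin n) ℂ)).mul_const
    ((g (e.1.shift e.2) : Matrix.specialUnitaryGroup (Fin n) ℂ) : Matrix (Fin n) (Fin n) ℂ)ᴴ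
  have hfun : (fun s => (g e.1 : Matrix (Fin n) (Fin n) ℂ) * WilsonFlow.coeConfig (Φ s V) e *
      ((g (e.1.shift e.2) : Matrix.specialUnitaryGroup (Fin n) ℂ) : Matrix (Fin n) (Fin n) ℂ)ᴴ) =
      fun s => WilsonFlow.coeConfig (gaugeTransform g (Φ s V)) e := by
    funext s; rw [coeConfig_gaugeTransform_apply]
  have hval : (g e.1 : Matrix (Fin n) (Fin n) ℂ) *
      (-linkGrad B (F t) (WilsonFlow.coeConfig (Φ t V)) e * WilsonFlow.coeConfig (Φ t V) e) *
        ((g (e.1.shift e.2) : Matrix.specialUnitaryGroup (Fin n) ℂ) : Matrix (Fin n) (Fin n) ℂ)ᴴ =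
      -linkGrad B (F t) (WilsonFlow.coeConfig (gaugeTransform g (Φ t V))) e *
        WilsonFlow.coeConfig (gaugeTransform g (Φ t V)) e := by
    rw [linkGrad_gaugeTransform B (hFi t) (hFd t) g (Φ t V) e, coeConfig_gaugeTransform_apply]
    simp only [Matrix.neg_mul, Matrix.mul_neg, ← Matrix.mul_assoc]
    rw [Matrix.mul_assoc ((g e.1 : Matrix (Fin n) (Fin n) ℂ) * linkGrad B (F t) _ e)
      ((g e.1 : Matrix (Fin n) (Fin n) ℂ)ᴴ) (g e.1 : Matrix (Fin n) (Fin n) ℂ),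
      WilsonFlow.conjTranspose_mul_self_SU, Matrix.mul_one]
  rw [hfun, hval] at h2
  exact WilsonFlow.hasDerivAt_entry h2 i j

/-- **Gradient flows of gauge-invariant actions are gauge EQUIVARIANT** (`Φ_t(V^g) = Φ_t(V)^g`), given
uniqueness of flow lines (e.g. from `FlowGlobalExistence`): both `t ↦ Φ_t(V^g)` and `t ↦ Φ_t(V)^g` are flow
lines from `V^g`. This is "the map preserves the gauge symmetry" for Lüscher's trivializing and truncated
maps (§4.3: the `S̃^{(k)}` are sums of products of Wilson loops). [cite: Luscher2010Trivializing, §3.1, §4.2–§4.3, §6] -/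
theorem isGaugeEquivariant_flowMap (B : SuBasis n) {F : ℝ → AmbConfig d L n → ℝ}
    (hFi : ∀ t, IsGaugeInvariant fun U : GaugeConfig d L (Matrix.specialUnitaryGroup (Fin n) ℂ) =>
      F t (WilsonFlow.coeConfig U))
    (hFd : ∀ t, Differentiable ℝ (F t))
    {Φ : ℝ → GaugeConfig d L (Matrix.specialUnitaryGroup (Fin n) ℂ) →
      GaugeConfig d L (Matrix.specialUnitaryGroup (Fin n) ℂ)}
    (hΦ : IsFlowMap (fun t W => -linkGrad B (F t) W) Φ)
    (huniq : ∀ (U : ℝ → AmbConfig d L n) (V : GaugeConfig d L (Matrix.specialUnitaryGroup (Fin n) ℂ)),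
      IsFlowLine (fun t W => -linkGrad B (F t) W) U → U 0 = WilsonFlow.coeConfig V →
        ∀ t, U t = WilsonFlow.coeConfig (Φ t V))
    (t : ℝ) : IsGaugeEquivariant (Φ t) := by
  intro g V
  apply WilsonFlow.coeConfig_injective
  have h0 : (fun s => WilsonFlow.coeConfig (gaugeTransform g (Φ s V))) 0 =
      WilsonFlow.coeConfig (gaugeTransform g V) := by
    show WilsonFlow.coeConfig (gaugeTransform g (Φ 0 V)) = _
    rw [hΦ.1 V]
  exact (huniq _ (gaugeTransform g V) (isFlowLine_gaugeTransform B hFi hFd g hΦ V) h0 t).symm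

/-- The same under the cited global-existence statement of §3.1 (which supplies uniqueness of flow lines),
for a jointly `C¹`, tangent gradient generator. [cite: Luscher2010Trivializing, §3.1] -/
theorem isGaugeEquivariant_flowMap_of_flowGlobalExistence (hGE : FlowGlobalExistence d L n) (B : SuBasis n)
    {F : ℝ → AmbConfig d L n → ℝ}
    (hFi : ∀ t, IsGaugeInvariant fun U : GaugeConfig d L (Matrix.specialUnitaryGroup (Fin n) ℂ) =>
      F t (WilsonFlow.coeConfig U))
    (hFd : ∀ t, Differentiable ℝ (F t))
    (hZ1 : ContDiff ℝ 1 fun p : ℝ × AmbConfig d L n => -linkGrad B (F p.1) p.2)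
    (hZt : Generator.IsTangent (fun t W => -linkGrad B (F t) W))
    {Φ : ℝ → GaugeConfig d L (Matrix.specialUnitaryGroup (Fin n) ℂ) →
      GaugeConfig d L (Matrix.specialUnitaryGroup (Fin n) ℂ)}
    (hΦ : IsFlowMap (fun t W => -linkGrad B (F t) W) Φ) (t : ℝ) : IsGaugeEquivariant (Φ t) := by
  obtain ⟨Φ₀, hΦ₀, -, huniq₀⟩ := hGE (fun t W => -linkGrad B (F t) W) hZ1 hZt
  have hΦeq : ∀ s V, Φ s V = Φ₀ s V := by
    intro s V
    apply WilsonFlow.coeConfig_injective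
    exact huniq₀ (fun s => WilsonFlow.coeConfig (Φ s V)) V (hΦ.2 V)
      (show WilsonFlow.coeConfig (Φ 0 V) = _ by rw [hΦ.1 V]) s
  have hfun : Φ = Φ₀ := funext fun s => funext fun V => hΦeq s V
  subst hfun
  exact isGaugeEquivariant_flowMap B hFi hFd hΦ huniq₀ t

/-- **Every truncated Lüscher map is gauge equivariant**: if the orders `S̃^{(k)}` are gauge invariant on
`SU(n)^E` and smooth (they are sums of products of Wilson loops, §4.3), the time-`t` maps of the flow of
`Z_t = -∂S̃^{[N]}_t` (§4.5(c)) are `IsGaugeEquivariant`, given uniqueness of its flow lines.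
[cite: Luscher2010Trivializing, §4.3, §4.5, §6] -/
theorem isGaugeEquivariant_truncFlow (B : SuBasis n) {Sk : ℕ → AmbConfig d L n → ℝ}
    (hSi : ∀ k, IsGaugeInvariant fun U : GaugeConfig d L (Matrix.specialUnitaryGroup (Fin n) ℂ) =>
      Sk k (WilsonFlow.coeConfig U))
    (hSk : ∀ k, ContDiff ℝ ∞ (Sk k)) (N : ℕ)
    {Φ : ℝ → GaugeConfig d L (Matrix.specialUnitaryGroup (Fin n) ℂ) →
      GaugeConfig d L (Matrix.specialUnitaryGroup (Fin n) ℂ)}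
    (hΦ : IsFlowMap (fun t W => -linkGrad B (truncFlowAction Sk t N) W) Φ)
    (huniq : ∀ (U : ℝ → AmbConfig d L n) (V : GaugeConfig d L (Matrix.specialUnitaryGroup (Fin n) ℂ)),
      IsFlowLine (fun t W => -linkGrad B (truncFlowAction Sk t N) W) U → U 0 = WilsonFlow.coeConfig V →
        ∀ t, U t = WilsonFlow.coeConfig (Φ t V))
    (t : ℝ) : IsGaugeEquivariant (Φ t) := by
  refine isGaugeEquivariant_flowMap B (F := fun t => truncFlowAction Sk t N) (fun s g U => ?_)
    (fun s => (contDiff_truncFlowAction hSk s N).differentiable (by simp)) hΦ huniq t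
  show (∑ k ∈ Finset.range (N + 1), s ^ k * Sk k (WilsonFlow.coeConfig (gaugeTransform g U))) =
    ∑ k ∈ Finset.range (N + 1), s ^ k * Sk k (WilsonFlow.coeConfig U)
  exact Finset.sum_congr rfl fun k _ => congrArg (fun x : ℝ => s ^ k * x) (hSi k g U)

end Flow

end Summit.Ventures.LatticeQCDFlow.TrivializingMaps
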